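import Mathlib.RingTheory.MvPolynomial.WeightedHomogeneous
import Mathlib.RingTheory.FiniteType
import Mathlib.RingTheory.RegularLocalRing.Polynomial
import Mathlib.Algebra.Order.Antidiag.Finsupp
import Mathlib.Data.ZMod.Basic
import Literature.AlgebraicGeometry.Resolution.AffineBlowupAlgebra
import Literature.AlgebraicGeometry.Resolution.AffineBlowup
import Summits.ResolutionOfSingularities.ResolutionOfSingularities.Theorems.FrobeniusLadderFRationalResolutionVeroneseRetract
import HarnessLib

/-!
# The Veronese subring `VR[n, r] ⊆ k[x₁,…,xₙ]` is a direct summand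

Support file for crux stmt-ResolutionOfSingularities-15317 (`FrobeniusLadder.FRationalResolution`), line `redirect`,
lead c5, CONE PROGRAMME (rung 4′ in all dimensions on the Veronese cones `V(n,r) = Spec k[χᵈ : |d| = r]`).
Given the membership criterion for the `r`-th Veronese subring `VR[n, r]` (a polynomial lies in it iff
all monomials of its support have total degree divisible by `r`), we prove that `VR[n, r]` is a direct
summand of `MP[n] = k[x₁,…,xₙ]`: there is an additive retraction `ρ : MP[n] →+ VR[n, r]` of the
inclusion which is `VR[n, r]`-linear. The map `ρ` is the Reynolds operator of `μ_r` written on degrees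
(so it also works in the wild case `p ∣ r`): the projection onto the weight-`0` component for the weight
`Fin n → ZMod r, _ ↦ 1`, i.e. onto the `k`-span of the monomials of degree `≡ 0 (mod r)`
(`MvPolynomial.weightedHomogeneousComponent`). [folklore; BrunsHerzog1998 §6.1, HochsterHuneke1990
discussion of Prop. 4.12]
-/

-- single-problem summit: the doubled namespace component is forced
set_option linter.dupNamespace false

noncomputable section

namespace Summit.ResolutionOfSingularities.ResolutionOfSingularities.Theorems.FRationalResolution

open MvPolynomial
open Literature.AlgebraicGeometry.Resolution

section Cones

variable (k : Type) [Field k]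

/-- The polynomial ring in `n` variables. -/
local notation3 "MP[" n "]" => MvPolynomial (Fin n) k

/-- The `r`-th Veronese subring of `k[x₁,…,xₙ]`: the `k`-subalgebra generated by the degree-`r` monomials. -/
local notation3 "VR[" n ", " r "]" =>
  Algebra.adjoin k ((fun d : Fin n →₀ ℕ => MvPolynomial.monomial d (1 : k)) ''
    {d : Fin n →₀ ℕ | Finsupp.degree d = (r : ℕ)})

/-- The vertex ideal of the Veronese cone: spanned by the degree-`r` monomials. -/
local notation3 "VM[" n ", " r "]" =>
  Ideal.span {v : ↥VR[n, r] | ∃ d : Fin n →₀ ℕ, Finsupp.degree d = (r : ℕ) ∧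
    (v : MvPolynomial (Fin n) k) = MvPolynomial.monomial d 1}

/-- For the constant weight `_ ↦ (1 : ZMod r)` on `Fin n`, the weight of an exponent vector `d` is its
total degree reduced mod `r`: `∑ i, d i • 1 = ↑(∑ i, d i)`. [folklore] -/
theorem veronese_summand_weight_eq_degree (n r : ℕ) (d : Fin n →₀ ℕ) :
    Finsupp.weight (fun _ : Fin n => (1 : ZMod r)) d = ((Finsupp.degree d : ℕ) : ZMod r) := by
  rw [Finsupp.weight_apply, Finsupp.degree_apply, Nat.cast_sum]
  simp only [Finsupp.sum, nsmul_one]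

/-- For the constant weight `_ ↦ (1 : ZMod r)` on `Fin n`, an exponent vector has weight `0` iff `r`
divides its total degree (`ZMod.natCast_eq_zero_iff`). [folklore] -/
theorem veronese_summand_weight_eq_zero_iff (n r : ℕ) (d : Fin n →₀ ℕ) :
    Finsupp.weight (fun _ : Fin n => (1 : ZMod r)) d = 0 ↔ r ∣ Finsupp.degree d := by
  rw [veronese_summand_weight_eq_degree, ZMod.natCast_eq_zero_iff]

/-- **The Veronese subring is a direct summand of the polynomial ring** (the Reynolds operator of `μ_r`
written on degrees, valid also for `p ∣ r`). Given the membership criterion `hmem` (a polynomial lies in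
`VR[n, r]` iff every monomial of its support has degree divisible by `r`), membership in `VR[n, r]` is
the same as being weighted homogeneous of weight `0` for the weight `w : Fin n → ZMod r, _ ↦ 1`
(`veronese_summand_weight_eq_zero_iff`). Hence the weight-`0` component
`E = MvPolynomial.weightedHomogeneousComponent w 0` is an additive map landing in `VR[n, r]`
(`weightedHomogeneousComponent_isWeightedHomogeneous`), fixing it
(`weightedHomogeneousComponent_eq_self`), and `VR[n, r]`-linear
(`veronese_retract_weightedHomogeneousComponent_mul`: in `coeff_mul` only the pairs whose first factor
has weight `0` contribute); `ρ f := ⟨E f, _⟩` is the required retraction. [folklore; BrunsHerzog1998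
§6.1, HochsterHuneke1990 Prop. 4.12 context] -/
theorem stub_veronese_retract (n r : ℕ) (hr : 1 ≤ r)
    (hmem : ∀ f : MP[n], f ∈ VR[n, r] ↔ ∀ d ∈ f.support, r ∣ Finsupp.degree d) :
    ∃ ρ : MP[n] →+ ↥VR[n, r], (∀ t : ↥VR[n, r], ρ (t : MP[n]) = t) ∧
      ∀ (t : ↥VR[n, r]) (g : MP[n]), ρ ((t : MP[n]) * g) = t * ρ g := by
  have _ := hr
  -- membership in the Veronese subring = weighted homogeneity of weight `0` for `w _ = 1 : ZMod r`
  have hhom : ∀ f : MP[n], f ∈ VR[n, r] ↔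
      IsWeightedHomogeneous (fun _ : Fin n => (1 : ZMod r)) f 0 := by
    intro f
    rw [hmem f]
    constructor
    · intro h d hd
      exact (veronese_summand_weight_eq_zero_iff n r d).mpr (h d (MvPolynomial.mem_support_iff.mpr hd))
    · intro h d hd
      exact (veronese_summand_weight_eq_zero_iff n r d).mp (h (MvPolynomial.mem_support_iff.mp hd))
  have hE : ∀ f : MP[n],
      weightedHomogeneousComponent (fun _ : Fin n => (1 : ZMod r)) 0 f ∈ VR[n, r] := fun f =>
    (hhom _).mpr (weightedHomogeneousComponent_isWeightedHomogeneous 0 f)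
  refine ⟨{ toFun := fun f => ⟨weightedHomogeneousComponent (fun _ : Fin n => (1 : ZMod r)) 0 f, hE f⟩
            map_zero' := Subtype.ext (map_zero _)
            map_add' := fun f g => Subtype.ext (map_add _ f g) }, fun t => Subtype.ext ?_,
    fun t g => Subtype.ext ?_⟩
  · exact weightedHomogeneousComponent_eq_self ((hhom _).mp t.2)
  · exact veronese_retract_weightedHomogeneousComponent_mul ((hhom _).mp t.2) 0 g

end Cones

end Summit.ResolutionOfSingularities.ResolutionOfSingularities.Theorems.FRationalResolution

end
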